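/-
Copyright (c) 2026 the pub-hodgecm-mathlib formalisation cell (harness21).  Prover seat hodgecm-mathlib-K2Liu-p02 (g10), Track B «K2-LIT» ∕ hLiu418
#184♮, Road I v3, unit U5 «THE CLOSE», FACE-D₀ (theta side, route (B3) «global unfolding»), brick B3-2c-idx, FILE 2∕2: THE INDEX MAP `Q` OF THE RATIONAL
κ-MULTIPLIER MODEL, ITS GRAM READING, AND THE MULTIPLIER LETTER `hmult` OF (KM′) (FACE-D₀ desk cut, K2 bus 2026-09-05T03:25Z ∕ 03:35Z).
THEOREMS ONLY (no `def`, no `instance`, no notation, no named-fact hypothesis, no `sorry`).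
-/
import Summits.HodgeConjecture.HodgeConjecture.Theorems.K2LiuKappaMultiplierIndexGramPrelim   -- this seat, FILE 1∕2: adelic Gram reading, reality
import Summits.HodgeConjecture.HodgeConjecture.Theorems.K2LiuLinePairKappaModelChirpGlobal    -- K2E3-p23 ★ p865126 B3-2c-op: `pairRep_line_lineCayley_eq_chirpLM`, `thetaDist_lineCayleyTg`
import Summits.HodgeConjecture.HodgeConjecture.Theorems.K2LiuTateCharacterBaseChange         -- K2E3-p26 ★ p865167 B3-ψ: `adeleAddChar_baseChange_cm_eq_add`
import Summits.HodgeConjecture.HodgeConjecture.Theorems.K2LiuHermitianSkewDictionary         -- F0P2-p10 ★ p864231: `smul_inv_mul_mem_skewMatrices`, `gramRL_*`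
import Summits.HodgeConjecture.HodgeConjecture.Theorems.K2LiuRankOneLineGram                 -- ★ U2c: `smul_vecMulVec_conj_eq_of_eq_mul_conj_mul_self`, `map_transpose_smul_vecMulVec_conj`
import HarnessLib

/-!
# K2_Liu road (hLiu418 = stmt-HodgeConjecture-24832), FACE-D₀ route (B3), brick B3-2c-idx FILE 2∕2: `K2LiuKappaMultiplierIndexGram`

Cell `pub/hodgecm-mathlib` (D-0151), Track B, build stream 29; helper lane `--supports stmt-HodgeConjecture-24832 --as helper`, count-neutral; closes no socket.

WHY.  Route (B3) unfolds the Fourier coefficient of a doubled line theta lift along `N_Δ(L⁺)\N_Δ(𝔸)` in the rational κ-multiplier model (K2E3-p37's (KM′),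
B3-2b `K2LiuDoubledLineThetaCoeffUnfolding`, letters `Tg hΘ Q hmult hQskew`): ★ p865126 B3-2c-op gives `Tg (ω(u) (Tg⁻¹ Ψ)) = t(S_u) Ψ` with `S_u = (−½) · c_{q_u}` in
★ p863869's CLOSED FORM and `hΘ`; THIS FILE supplies the index map and the remaining letters:
* §4 **the index map** `Q ξ := (δ · a′∕(4d)) • (T_L⁻¹ · c(y₀ ξ) ⊗ y₀ ξ)` (inline, no `def`; `y₀ ξ ∈ Lⁿ` the rational vector `(ξ_p · gramR) ⊗ 1 − 2δ (ξ_q ⊗ 1)` of the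
  `e₁′ ∘ e₂` split of `ξ`), **`sdChar_negHalf_chirpBlock_ratPt_eq_unipDeltaChar`**: `ψ_{L⁺}(q_{S_u}(ξ)) = ψ_{Q ξ}(u)` for every `u ∈ N_Δ(𝔸)` and rational `ξ`
  (FILE 1 §2–§3 + ★ B3-ψ `adeleAddChar_baseChange_cm_eq_add` — UNCONDITIONAL), **`Q_mem_skewMatrices`** (`hQskew`), **`exists_Q_eq_dictNeg`** (`hQ` of ★ B3-3 ED. 2
  `hfib_of_indexMap_skew`: `Q ξ = dict′(a′ • c(ξ′) ⊗ ξ′)` — label exactly `a′` under the `−δ` keying of RULING M-160i, since `a′∕(4d) = (−a′)·Nm((2δ)⁻¹)`);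
* §5 **`kappaMultiplier_ratPt`** = (KM′)'s letter `hmult` BY NAME: `(Tg (ω(u) (Tg⁻¹ Ψ)))(ratPt ξ) = ψ_{Q ξ}(u) · Ψ(ratPt ξ)` (★ B3-2c-op §3 at
  `hS := ★ aMat_cMat_lineKappa_of_mem_unipDelta (.2)` ∘ §4).
After this file B3-2b's letters are ALL ★ by name: `Tg` (explicit), `hΘ := thetaDist_lineCayleyTg`, `Q` (explicit), `hmult := kappaMultiplier_ratPt`, `hQskew := Q_mem_skewMatrices`,
and B3-3's `hQ := exists_Q_eq_dictNeg`.
No definition, no instance, no notation, no named-fact hypothesis, no `sorry`; axioms ⊆ {propext, Classical.choice, Quot.sound}.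
HONEST LABEL: `hsign₂′` NOT discharged by this file (B3-2b + the tie do that); HC_CM is proved only modulo the 7 printed citations (2 remaining named inputs:
hLiu418 = stmt-HodgeConjecture-24832, h413 = stmt-HodgeConjecture-24833) until rung 0 closes; count-neutral.

References: [Kudla1994] S. S. Kudla, Israel J. Math. 87 (1994), §2–§3; [Weil1964] A. Weil, Acta Math. 111 (1964), Chap. I n° 13 p. 160, n° 34 p. 184, Chap. III n° 41;
[KudlaRallis1994] §3; [Shimura1997] §18.1 (18.4); [CasselsFrohlichANT1967] Ch. II §14, Ch. XV §4.1; [Liu2021] Def. 4.11–4.12, App. B Prop. B.8 p. 104; [Scharlau1985HermitianForms] Ch. 10 §1.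
-/

set_option autoImplicit false
set_option linter.dupNamespace false -- the mandated namespace repeats `HodgeConjecture.HodgeConjecture`
-- §5 carries the line-pair carriers; elaborate sequentially (as ★ p865126)
set_option Elab.async false

noncomputable section

open scoped Matrix
open NumberField IsDedekindDomain
open Literature.NumberTheory.Automorphic Literature.NumberTheory.Automorphic.UnitaryGroup Literature.NumberTheory.GaloisRepresentations
open Literature.NumberTheory.Automorphic.UnitaryGroup.QuadraticCoordinates
open Literature.NumberTheory.Automorphic.IdeleClassGroup
open Literature.NumberTheory.Automorphic.Liu2021 Literature.NumberTheory.Automorphic.Liu2021.Def411WeilCarriers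
open Literature.NumberTheory.Automorphic.Liu2021.Def411WeilCarriersDoubling
open Literature.RepresentationTheory.HeisenbergGroup Literature.RepresentationTheory.Liu2021
open Literature.NumberTheory.GelbartRogawski1991 Literature.NumberTheory.GelbartRogawski1991.GRConstruction
open Literature.NumberTheory.GelbartRogawski1991.UnitaryDualPair
open Literature.NumberTheory.K2Lit.SiegelDoubled Literature.NumberTheory.K2Lit.DoubledLineTheta
open Literature.NumberTheory.Weil1964
open Summit.HodgeConjecture.HodgeConjecture.Cruxes.HLiu418.K2LiuSiegelUnipotentFourierDefs
open Summit.HodgeConjecture.HodgeConjecture.Cruxes.HLiu418.K2LiuSiegelUnipotentCharacters (algebraMap_complexConj)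
open Summit.HodgeConjecture.HodgeConjecture.Cruxes.HLiu418.K2LiuRankOneLineGram (smul_vecMulVec_conj_eq_of_eq_mul_conj_mul_self map_transpose_smul_vecMulVec_conj)
open Summit.HodgeConjecture.HodgeConjecture.Cruxes.HLiu418.K2LiuLinePairCayleySiegel (lineCayleyMover_mem_symplecticGroup)
open Summit.HodgeConjecture.HodgeConjecture.Cruxes.HLiu418.K2LiuLinePairCayleySiegelUnipotent (aMat_cMat_lineKappa_of_mem_unipDelta)
open Summit.HodgeConjecture.HodgeConjecture.Cruxes.HLiu418.K2LiuLinePairKappaModelChirpGlobal (pairRep_line_lineCayley_eq_chirpLM)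
open Summit.HodgeConjecture.HodgeConjecture.Cruxes.HLiu418.K2LiuKappaMultiplierIndexGramPrelim

namespace Summit.HodgeConjecture.HodgeConjecture.Cruxes.HLiu418.K2LiuKappaMultiplierIndexGram

/-! ## §4 The index map `Q`, the character identity at rational points, `hQskew`, `hQ` -/

section Index

variable (L : Type) [Field L] [NumberField L] [IsCMField L]
variable {N M n : ℕ} (e : Fin N × Fin M ≃ Fin n)
  (dV : Fin N → L) (hdV : ∀ i, IsCMField.complexConj L (dV i) = dV i) (hdV0 : ∀ i, dV i ≠ 0)
  (dW : Fin M → L) (hdW : ∀ i, IsCMField.complexConj L (dW i) = dW i) (hdW0 : ∀ i, dW i ≠ 0)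
variable {n'' : ℕ} (e₁ : Fin (n + n) × Fin 1 ≃ Fin n'') (a' : (Fp L)ˣ)

/-- a ring hom through `T⁻¹` (unit determinant). [folklore] -/
theorem map_nonsing_inv_of_isUnit {A B : Type*} [CommRing A] [CommRing B] (f : A →+* B) {ι : Type*} [Fintype ι] [DecidableEq ι]
    (T : Matrix ι ι A) (hT : IsUnit T.det) : (T⁻¹).map f = (T.map f)⁻¹ :=
  (Matrix.inv_eq_right_inv (by rw [← Matrix.map_mul, Matrix.mul_nonsing_inv T hT, Matrix.map_one _ (map_zero f) (map_one f)])).symm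

/-- `reindex` commutes with scalars. [folklore] -/
theorem reindex_smul {R : Type*} [CommRing R] {ι κ : Type*} (eι : ι ≃ κ) (c : R) (M : Matrix ι ι R) :
    Matrix.reindex eι eι (c • M) = c • Matrix.reindex eι eι M :=
  Matrix.ext fun _ _ => rfl

/-- `(2δ)⁻¹ · c((2δ)⁻¹) = −(4d)⁻¹` in the CM field (`c δ = −δ`, `δ² = d`): the norm of `(2δ)⁻¹`. [cite: Liu2021, Def. 4.11–4.12] -/
theorem conj_inv_two_mul_imagUnit_mul :
    IsCMField.complexConj L (2 * imagUnit L)⁻¹ * (2 * imagUnit L)⁻¹ = -algebraMap (Fp L) L (4 * imagUnitSq L)⁻¹ := by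
  have h2δ : (2 * imagUnit L) ≠ 0 := mul_ne_zero two_ne_zero (imagUnit_ne_zero L)
  rw [map_inv₀, map_mul, map_ofNat, complexConj_imagUnit, ← mul_inv, map_inv₀, map_mul, map_ofNat, ← imagUnit_mul_self,
    show (2 * -imagUnit L) * (2 * imagUnit L) = -(4 * (imagUnit L * imagUnit L)) by ring, inv_neg]

include hdV0 hdW0 in
/-- **THE INDEX MAP IS `T_L`-SKEW** (`hQskew` of (KM′)): `Q ξ = δ • (T_L⁻¹ · ((a′∕(4d)) • c(y₀) ⊗ y₀))` with `(a′∕(4d)) • c(y₀) ⊗ y₀` hermitian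
(★ `map_transpose_smul_vecMulVec_conj`), hence `T_L`-skew (★ `smul_inv_mul_mem_skewMatrices`). [cite: Shimura1997, §18.1 (18.4)] -/
theorem Q_mem_skewMatrices (ξ : Fin n'' → Fp L) :
    (imagUnit L * algebraMap (Fp L) L ((a' : Fp L) / (4 * imagUnitSq L))) •
        (((gramR L e dV hdV dW hdW).map (algebraMap (Fp L) L))⁻¹ *
          Matrix.vecMulVec (⇑(IsCMField.complexConj L) ∘ fun i =>
              algebraMap (Fp L) L (((fun j => ξ (((e₂ (n := n)).trans ((Equiv.prodUnique (Fin (n + n)) (Fin 1)).symm.trans e₁)) (Sum.inl j))) ᵥ*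
                gramR L e dV hdV dW hdW) i) - 2 * (algebraMap (Fp L) L (ξ (((e₂ (n := n)).trans ((Equiv.prodUnique (Fin (n + n)) (Fin 1)).symm.trans e₁)) (Sum.inr i))) * imagUnit L))
            (fun i => algebraMap (Fp L) L (((fun j => ξ (((e₂ (n := n)).trans ((Equiv.prodUnique (Fin (n + n)) (Fin 1)).symm.trans e₁)) (Sum.inl j))) ᵥ*
                gramR L e dV hdV dW hdW) i) - 2 * (algebraMap (Fp L) L (ξ (((e₂ (n := n)).trans ((Equiv.prodUnique (Fin (n + n)) (Fin 1)).symm.trans e₁)) (Sum.inr i))) * imagUnit L))) ∈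
      skewMatrices ((IsCMField.complexConj L : L ≃ₐ[Fp L] L) : L →+* L) ((gramR L e dV hdV dW hdW).map (algebraMap (Fp L) L)) := by
  set y₀ : Fin n → L := fun i =>
    algebraMap (Fp L) L (((fun j => ξ (((e₂ (n := n)).trans ((Equiv.prodUnique (Fin (n + n)) (Fin 1)).symm.trans e₁)) (Sum.inl j))) ᵥ*
      gramR L e dV hdV dW hdW) i) - 2 * (algebraMap (Fp L) L (ξ (((e₂ (n := n)).trans ((Equiv.prodUnique (Fin (n + n)) (Fin 1)).symm.trans e₁)) (Sum.inr i))) * imagUnit L) with hy₀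
  rw [← smul_smul, ← Matrix.mul_smul]
  refine K2LiuHermitianSkewDictionary.smul_inv_mul_mem_skewMatrices _ (K2LiuHermitianSkewDictionary.gramRL_isSymm L e dV hdV dW hdW)
    (K2LiuHermitianSkewDictionary.map_gramRL_complexConj L e dV hdV dW hdW) (K2LiuHermitianSkewDictionary.isUnit_det_gramRL L e dV hdV dW hdW hdV0 hdW0)
    (complexConj_imagUnit L) _ ?_
  exact map_transpose_smul_vecMulVec_conj (IsCMField.complexConj L : L →+* L) (IsCMField.complexConj_apply_apply (K := L))
    ((IsCMField.complexConj_eq_self_iff (K := L) _).2 (Subtype.coe_prop ((a' : Fp L) / (4 * imagUnitSq L)))) y₀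

/-- **THE GRAM READING OF THE INDEX MAP** (`hQ` of ★ B3-3 ED. 2 `hfib_of_indexMap_skew`): `Q ξ = (−δ) • (T_L⁻¹ · (a′ • c(ξ′) ⊗ ξ′)^{ρ⁻¹})` with
`ξ′ := (2δ)⁻¹ • (y₀ ∘ ρ⁻¹)` — the label is exactly `a′` under the `−δ` keying of RULING M-160i, because `a′∕(4d) = (−a′) · Nm((2δ)⁻¹)`
(★ `smul_vecMulVec_conj_eq_of_eq_mul_conj_mul_self`). [cite: Liu2021, Def. 4.11–4.12; App. B Prop. B.8 p. 104] [cite: Scharlau1985HermitianForms, Ch. 10 §1] -/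
theorem exists_Q_eq_dictNeg (ρ : Fin n ≃ Fin 2) (ξ : Fin n'' → Fp L) :
    ∃ ξ' : Fin 2 → L,
      (imagUnit L * algebraMap (Fp L) L ((a' : Fp L) / (4 * imagUnitSq L))) •
          (((gramR L e dV hdV dW hdW).map (algebraMap (Fp L) L))⁻¹ *
            Matrix.vecMulVec (⇑(IsCMField.complexConj L) ∘ fun i =>
                algebraMap (Fp L) L (((fun j => ξ (((e₂ (n := n)).trans ((Equiv.prodUnique (Fin (n + n)) (Fin 1)).symm.trans e₁)) (Sum.inl j))) ᵥ*
                  gramR L e dV hdV dW hdW) i) - 2 * (algebraMap (Fp L) L (ξ (((e₂ (n := n)).trans ((Equiv.prodUnique (Fin (n + n)) (Fin 1)).symm.trans e₁)) (Sum.inr i))) * imagUnit L))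
              (fun i => algebraMap (Fp L) L (((fun j => ξ (((e₂ (n := n)).trans ((Equiv.prodUnique (Fin (n + n)) (Fin 1)).symm.trans e₁)) (Sum.inl j))) ᵥ*
                  gramR L e dV hdV dW hdW) i) - 2 * (algebraMap (Fp L) L (ξ (((e₂ (n := n)).trans ((Equiv.prodUnique (Fin (n + n)) (Fin 1)).symm.trans e₁)) (Sum.inr i))) * imagUnit L))) =
        (-imagUnit L) • ((((gramR L e dV hdV dW hdW).map (algebraMap (Fp L) L))⁻¹ *
          Matrix.reindex ρ.symm ρ.symm (algebraMap (Fp L) L (a' : Fp L) • Matrix.vecMulVec (⇑(IsCMField.complexConj L) ∘ ξ') ξ'))) := by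
  set y₀ : Fin n → L := fun i =>
    algebraMap (Fp L) L (((fun j => ξ (((e₂ (n := n)).trans ((Equiv.prodUnique (Fin (n + n)) (Fin 1)).symm.trans e₁)) (Sum.inl j))) ᵥ*
      gramR L e dV hdV dW hdW) i) - 2 * (algebraMap (Fp L) L (ξ (((e₂ (n := n)).trans ((Equiv.prodUnique (Fin (n + n)) (Fin 1)).symm.trans e₁)) (Sum.inr i))) * imagUnit L) with hy₀
  refine ⟨(2 * imagUnit L)⁻¹ • (y₀ ∘ ρ.symm), ?_⟩
  -- the label: `−(a′∕(4d)) = a′ · c((2δ)⁻¹) · (2δ)⁻¹`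
  have hd0 : (imagUnitSq L : Fp L) ≠ 0 := by
    intro h0
    have h1 : imagUnit L * imagUnit L = 0 := by rw [imagUnit_mul_self, h0, map_zero]
    exact imagUnit_ne_zero L (mul_self_eq_zero.1 h1)
  have hlabel : -algebraMap (Fp L) L ((a' : Fp L) / (4 * imagUnitSq L)) =
      algebraMap (Fp L) L (a' : Fp L) * (IsCMField.complexConj L (2 * imagUnit L)⁻¹ * (2 * imagUnit L)⁻¹) := by
    rw [conj_inv_two_mul_imagUnit_mul L, mul_neg, ← map_mul, div_eq_mul_inv]
  -- the Gram of `(2δ)⁻¹ • y₀` re-enumerated by `ρ`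
  have hG : Matrix.reindex ρ.symm ρ.symm (algebraMap (Fp L) L (a' : Fp L) •
      Matrix.vecMulVec (⇑(IsCMField.complexConj L) ∘ ((2 * imagUnit L)⁻¹ • (y₀ ∘ ρ.symm))) ((2 * imagUnit L)⁻¹ • (y₀ ∘ ρ.symm))) =
      algebraMap (Fp L) L (a' : Fp L) • Matrix.vecMulVec (⇑(IsCMField.complexConj L) ∘ ((2 * imagUnit L)⁻¹ • y₀)) ((2 * imagUnit L)⁻¹ • y₀) := by
    ext i j
    simp only [Matrix.reindex_apply, Matrix.submatrix_apply, Equiv.symm_symm, Matrix.smul_apply, Matrix.vecMulVec_apply, Function.comp_apply, Pi.smul_apply,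
      Equiv.symm_apply_apply]
  have h' : algebraMap (Fp L) L (a' : Fp L) • Matrix.vecMulVec (⇑(IsCMField.complexConj L) ∘ ((2 * imagUnit L)⁻¹ • y₀)) ((2 * imagUnit L)⁻¹ • y₀) =
      (-algebraMap (Fp L) L ((a' : Fp L) / (4 * imagUnitSq L))) • Matrix.vecMulVec (⇑(IsCMField.complexConj L) ∘ y₀) y₀ :=
    (smul_vecMulVec_conj_eq_of_eq_mul_conj_mul_self (IsCMField.complexConj L : L →+* L) hlabel y₀).symm
  rw [hG, h', Matrix.mul_smul, smul_smul, neg_mul_neg]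

include hdV0 hdW0 in
set_option maxHeartbeats 800000 in -- the statement carries ★ p863869's closed-form block over the adele ring (as ★ `aMat_cMat_lineKappa_of_mem_unipDelta`, 800000 measured there)
/-- **THE CHARACTER IDENTITY AT RATIONAL POINTS: `ψ_{L⁺}(q_{S_u}(ξ)) = ψ_{Q ξ}(u)`.**  For `u ∈ N_Δ(𝔸)` with frame coordinate `X_u = (blk u)₁₂`, the adelic second-degree
character of the chirp parameter `S_u = (−½) · c_{q_u}` (★ p863869's CLOSED FORM `1ᵀ · reindex_{e₁′}(reindex_{e₂}(a′ • J₂ · Res(−X_u − X_u) · D₂(½)))`, the `hS`-RHS of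
★ B3-2c-op `pairRep_line_lineCayley_eq_chirpLM`) at the rational point `ratPt ξ` equals the unipotent character of the index `Q ξ` at `u`:
`sdChar ((−⅟2) • c_{q_u}) (ratPt ξ) = ψ_{Q ξ}(u)` — §2 (`= ψ_{L⁺}(2 · re tr((Q ξ)_𝔸 X_u))`), §3 (`tr((Q ξ)_𝔸 X_u) = (re tr) ⊗ 1`) and the Tate-character base change
`ψ_L(r ⊗ 1) = ψ_{L⁺}(r + r)` (★ B3-ψ `K2LiuTateCharacterBaseChange.adeleAddChar_baseChange_cm_eq_add`, K2E3-p26) — UNCONDITIONAL.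
[cite: Kudla1994, §3] [cite: Weil1964, Chap. I n° 34 p. 184] [cite: Shimura1997, §18.1 (18.4)] [cite: CasselsFrohlichANT1967, Ch. XV §4.1] -/
theorem sdChar_negHalf_chirpBlock_ratPt_eq_unipDeltaChar
    {u : HA L e dV hdV dW hdW} (hu : u ∈ unipDelta L e dV hdV dW hdW) (ξ : Fin n'' → Fp L) :
    sdChar (Fp L) ((-⅟(2 : AdeleRing (𝓞 (Fp L)) (Fp L))) •
        ((1 : Matrix (Fin n'') (Fin n'') (AdeleRing (𝓞 (Fp L)) (Fp L)))ᵀ *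
          Matrix.reindex ((Equiv.prodUnique (Fin (n + n)) (Fin 1)).symm.trans e₁) ((Equiv.prodUnique (Fin (n + n)) (Fin 1)).symm.trans e₁)
            (Matrix.reindex (e₂ (n := n)) (e₂ (n := n))
            (algebraMap (Fp L) (AdeleRing (𝓞 (Fp L)) (Fp L)) (a' : Fp L) •
            (Matrix.fromBlocks 0 1 (-((2 : (AdeleRing (𝓞 (Fp L)) (Fp L))) • 1)) 0 *
            (Matrix.fromBlocks ((-(blk L e dV hdV dW hdW u).toBlocks₁₂ - (blk L e dV hdV dW hdW u).toBlocks₁₂).map (re (quadraticAdeleEquiv (Fp L) L (IsCMField.complexConj L) (complexConj_imagUnit L) (imagUnit_ne_zero L)).toAddEquiv))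
              ((algebraMap (Fp L) (AdeleRing (𝓞 (Fp L)) (Fp L)) (imagUnitSq L)) • ((-(blk L e dV hdV dW hdW u).toBlocks₁₂ - (blk L e dV hdV dW hdW u).toBlocks₁₂).map (im (quadraticAdeleEquiv (Fp L) L (IsCMField.complexConj L) (complexConj_imagUnit L) (imagUnit_ne_zero L)).toAddEquiv) * ((gramR L e dV hdV dW hdW).map (algebraMap (Fp L) (AdeleRing (𝓞 (Fp L)) (Fp L))))⁻¹))
              (((gramR L e dV hdV dW hdW).map (algebraMap (Fp L) (AdeleRing (𝓞 (Fp L)) (Fp L)))) * (-(blk L e dV hdV dW hdW u).toBlocks₁₂ - (blk L e dV hdV dW hdW u).toBlocks₁₂).map (im (quadraticAdeleEquiv (Fp L) L (IsCMField.complexConj L) (complexConj_imagUnit L) (imagUnit_ne_zero L)).toAddEquiv))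
              (((gramR L e dV hdV dW hdW).map (algebraMap (Fp L) (AdeleRing (𝓞 (Fp L)) (Fp L)))) * (-(blk L e dV hdV dW hdW u).toBlocks₁₂ - (blk L e dV hdV dW hdW u).toBlocks₁₂).map (re (quadraticAdeleEquiv (Fp L) L (IsCMField.complexConj L) (complexConj_imagUnit L) (imagUnit_ne_zero L)).toAddEquiv) * ((gramR L e dV hdV dW hdW).map (algebraMap (Fp L) (AdeleRing (𝓞 (Fp L)) (Fp L))))⁻¹)) *
            Matrix.fromBlocks ((⅟(2 : (AdeleRing (𝓞 (Fp L)) (Fp L)))) • 1) 0 0 1)))))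
        (ratPt (Fp L) (Fin n'') ξ) =
      ((unipDeltaChar L e dV hdV dW hdW
        ((imagUnit L * algebraMap (Fp L) L ((a' : Fp L) / (4 * imagUnitSq L))) •
          (((gramR L e dV hdV dW hdW).map (algebraMap (Fp L) L))⁻¹ *
            Matrix.vecMulVec (⇑(IsCMField.complexConj L) ∘ fun i =>
                algebraMap (Fp L) L (((fun j => ξ (((e₂ (n := n)).trans ((Equiv.prodUnique (Fin (n + n)) (Fin 1)).symm.trans e₁)) (Sum.inl j))) ᵥ*
                  gramR L e dV hdV dW hdW) i) - 2 * (algebraMap (Fp L) L (ξ (((e₂ (n := n)).trans ((Equiv.prodUnique (Fin (n + n)) (Fin 1)).symm.trans e₁)) (Sum.inr i))) * imagUnit L))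
              (fun i => algebraMap (Fp L) L (((fun j => ξ (((e₂ (n := n)).trans ((Equiv.prodUnique (Fin (n + n)) (Fin 1)).symm.trans e₁)) (Sum.inl j))) ᵥ*
                  gramR L e dV hdV dW hdW) i) - 2 * (algebraMap (Fp L) L (ξ (((e₂ (n := n)).trans ((Equiv.prodUnique (Fin (n + n)) (Fin 1)).symm.trans e₁)) (Sum.inr i))) * imagUnit L))))
        u : Circle) : ℂ) := by
  -- the Tate-character base change `ψ_L(r ⊗ 1) = ψ_{L⁺}(r + r)` (★ B3-ψ, K2E3-p26)
  have hψ : ∀ r : AdeleRing (𝓞 (Fp L)) (Fp L), adeleAddChar L (AdeleRing.baseChange (Fp L) L r) = adeleAddChar (Fp L) (r + r) :=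
    fun r => K2LiuTateCharacterBaseChange.adeleAddChar_baseChange_cm_eq_add L r
  -- the two §3 inputs FIRST (so that the `set` abbreviations below rewrite them too)
  have hskew := Q_mem_skewMatrices L e dV hdV hdV0 dW hdW hdW0 e₁ a' ξ
  have hreal := conjAdele_trace_mul_toBlocks₁₂ L e dV hdV hdV0 dW hdW hdW0 hskew hu
  -- abbreviations
  set ε : Fin n ⊕ Fin n ≃ Fin n'' := (e₂ (n := n)).trans ((Equiv.prodUnique (Fin (n + n)) (Fin 1)).symm.trans e₁) with hε
  set X := (blk L e dV hdV dW hdW u).toBlocks₁₂ with hX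
  set TA := (gramR L e dV hdV dW hdW).map (algebraMap (Fp L) (AdeleRing (𝓞 (Fp L)) (Fp L))) with hTA
  set x := ratPt (Fp L) (Fin n'') ξ with hx
  set p : Fin n → AdeleRing (𝓞 (Fp L)) (Fp L) := fun j => x (ε (Sum.inl j)) with hp
  set q : Fin n → AdeleRing (𝓞 (Fp L)) (Fp L) := fun j => x (ε (Sum.inr j)) with hq
  set y₀ : Fin n → L := fun i =>
    algebraMap (Fp L) L (((fun j => ξ (ε (Sum.inl j))) ᵥ* gramR L e dV hdV dW hdW) i) - 2 * (algebraMap (Fp L) L (ξ (ε (Sum.inr i))) * imagUnit L) with hy₀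
  have hTu : IsUnit TA.det := by
    rw [hTA, ← RingHom.mapMatrix_apply, ← RingHom.map_det]
    exact (isUnit_det_gram (Fp L) e (isUnit_det_realDiagonal L dV hdV hdV0) (isUnit_det_realDiagonal L dW hdW hdW0)).map _
  have hTt : TAᵀ = TA := by rw [hTA, ← Matrix.transpose_map, (gramR_isSymm L e dV hdV dW hdW).eq]
  have hbc : ∀ r : Fp L, AdeleRing.baseChange (Fp L) L (algebraMap (Fp L) (AdeleRing (𝓞 (Fp L)) (Fp L)) r) = algebraMap L (AdeleRing (𝓞 L) L) (algebraMap (Fp L) L r) :=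
    fun r => AdeleRing.baseChange_algebraMap (Fp L) L r
  -- (1) the left-hand side is `ψ_{L⁺}(2 · re τ)` by §2
  have hpq : (x ∘ ⇑((Equiv.prodUnique (Fin (n + n)) (Fin 1)).symm.trans e₁)) ∘ ⇑(e₂ (n := n)) = Sum.elim p q := (sumElim_comp_inl_inr (x ∘ ⇑ε)).symm
  have hLHS : sdForm (Fp L) ((-⅟(2 : AdeleRing (𝓞 (Fp L)) (Fp L))) •
        ((1 : Matrix (Fin n'') (Fin n'') (AdeleRing (𝓞 (Fp L)) (Fp L)))ᵀ *
          Matrix.reindex ((Equiv.prodUnique (Fin (n + n)) (Fin 1)).symm.trans e₁) ((Equiv.prodUnique (Fin (n + n)) (Fin 1)).symm.trans e₁)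
            (Matrix.reindex (e₂ (n := n)) (e₂ (n := n))
            (algebraMap (Fp L) (AdeleRing (𝓞 (Fp L)) (Fp L)) (a' : Fp L) •
            (Matrix.fromBlocks 0 1 (-((2 : (AdeleRing (𝓞 (Fp L)) (Fp L))) • 1)) 0 *
            (Matrix.fromBlocks ((-X - X).map (re (quadraticAdeleEquiv (Fp L) L (IsCMField.complexConj L) (complexConj_imagUnit L) (imagUnit_ne_zero L)).toAddEquiv))
              ((algebraMap (Fp L) (AdeleRing (𝓞 (Fp L)) (Fp L)) (imagUnitSq L)) • ((-X - X).map (im (quadraticAdeleEquiv (Fp L) L (IsCMField.complexConj L) (complexConj_imagUnit L) (imagUnit_ne_zero L)).toAddEquiv) * TA⁻¹))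
              (TA * (-X - X).map (im (quadraticAdeleEquiv (Fp L) L (IsCMField.complexConj L) (complexConj_imagUnit L) (imagUnit_ne_zero L)).toAddEquiv))
              (TA * (-X - X).map (re (quadraticAdeleEquiv (Fp L) L (IsCMField.complexConj L) (complexConj_imagUnit L) (imagUnit_ne_zero L)).toAddEquiv) * TA⁻¹)) *
            Matrix.fromBlocks ((⅟(2 : (AdeleRing (𝓞 (Fp L)) (Fp L)))) • 1) 0 0 1))))) x =
      2 * re (quadraticAdeleEquiv (Fp L) L (IsCMField.complexConj L) (complexConj_imagUnit L) (imagUnit_ne_zero L)).toAddEquiv (Matrix.trace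
        ((algebraMap L (AdeleRing (𝓞 L) L) (imagUnit L) • (X * TA⁻¹.map (AdeleRing.baseChange (Fp L) L))) *
          (AdeleRing.baseChange (Fp L) L (algebraMap (Fp L) (AdeleRing (𝓞 (Fp L)) (Fp L)) ((a' : Fp L) / (4 * imagUnitSq L))) •
            Matrix.vecMulVec (conjAdele (Fp L) L (IsCMField.complexConj L) ∘ fun i =>
                AdeleRing.baseChange (Fp L) L ((p ᵥ* TA) i) - 2 * (AdeleRing.baseChange (Fp L) L (q i) * algebraMap L (AdeleRing (𝓞 L) L) (imagUnit L)))
              (fun i => AdeleRing.baseChange (Fp L) L ((p ᵥ* TA) i) - 2 * (AdeleRing.baseChange (Fp L) L (q i) * algebraMap L (AdeleRing (𝓞 L) L) (imagUnit L)))))) := by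
    rw [sdForm_apply, transpose_one_mul, ← reindex_smul, ← reindex_smul, vecMul_reindex_dotProduct, vecMul_reindex_dotProduct, hpq]
    exact sdForm_chirpBlock_eq_two_mul_re L X TA hTt hTu p q (a' : Fp L)
  -- (2) the adelic vector `y` is the image of the rational vector `y₀`
  have hy : (fun i => AdeleRing.baseChange (Fp L) L ((p ᵥ* TA) i) - 2 * (AdeleRing.baseChange (Fp L) L (q i) * algebraMap L (AdeleRing (𝓞 L) L) (imagUnit L))) =
      ⇑(algebraMap L (AdeleRing (𝓞 L) L)) ∘ y₀ := by
    funext i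
    have h1 : (p ᵥ* TA) i = algebraMap (Fp L) (AdeleRing (𝓞 (Fp L)) (Fp L)) (((fun j => ξ (ε (Sum.inl j))) ᵥ* gramR L e dV hdV dW hdW) i) :=
      (RingHom.map_vecMul (algebraMap (Fp L) (AdeleRing (𝓞 (Fp L)) (Fp L))) (gramR L e dV hdV dW hdW) (fun j => ξ (ε (Sum.inl j))) i).symm
    have h2 : q i = algebraMap (Fp L) (AdeleRing (𝓞 (Fp L)) (Fp L)) (ξ (ε (Sum.inr i))) := rfl
    rw [h1, h2, hbc, hbc]
    simp only [Function.comp_apply, hy₀, map_sub, map_mul, map_ofNat]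
  -- (3) the index read over `𝔸_L`: `(Q ξ)_𝔸 · X_u` has the trace of §2's argument
  have hTmap : ((gramR L e dV hdV dW hdW).map (algebraMap (Fp L) L)).map (algebraMap L (AdeleRing (𝓞 L) L)) = TA.map (AdeleRing.baseChange (Fp L) L) := by
    rw [hTA, Matrix.map_map, Matrix.map_map]
    exact congrArg _ (funext fun r => (hbc r).symm)
  have hTi : (((gramR L e dV hdV dW hdW).map (algebraMap (Fp L) L))⁻¹).map (algebraMap L (AdeleRing (𝓞 L) L)) = TA⁻¹.map (AdeleRing.baseChange (Fp L) L) := by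
    rw [map_nonsing_inv_of_isUnit _ _ (K2LiuHermitianSkewDictionary.isUnit_det_gramRL L e dV hdV dW hdW hdV0 hdW0), map_nonsing_inv_of_isUnit _ _ hTu, hTmap]
  have hG : (Matrix.vecMulVec (⇑(IsCMField.complexConj L) ∘ y₀) y₀).map (algebraMap L (AdeleRing (𝓞 L) L)) =
      Matrix.vecMulVec (conjAdele (Fp L) L (IsCMField.complexConj L) ∘ (⇑(algebraMap L (AdeleRing (𝓞 L) L)) ∘ y₀)) (⇑(algebraMap L (AdeleRing (𝓞 L) L)) ∘ y₀) :=
    map_vecMulVec_conj (algebraMap L (AdeleRing (𝓞 L) L)) (⇑(IsCMField.complexConj L)) (conjAdele (Fp L) L (IsCMField.complexConj L))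
      (fun z => algebraMap_complexConj L z) y₀
  have htrace : Matrix.trace (((imagUnit L * algebraMap (Fp L) L ((a' : Fp L) / (4 * imagUnitSq L))) •
        (((gramR L e dV hdV dW hdW).map (algebraMap (Fp L) L))⁻¹ * Matrix.vecMulVec (⇑(IsCMField.complexConj L) ∘ y₀) y₀)).map (algebraMap L (AdeleRing (𝓞 L) L)) * X) =
      Matrix.trace ((algebraMap L (AdeleRing (𝓞 L) L) (imagUnit L) • (X * TA⁻¹.map (AdeleRing.baseChange (Fp L) L))) *
          (AdeleRing.baseChange (Fp L) L (algebraMap (Fp L) (AdeleRing (𝓞 (Fp L)) (Fp L)) ((a' : Fp L) / (4 * imagUnitSq L))) •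
            Matrix.vecMulVec (conjAdele (Fp L) L (IsCMField.complexConj L) ∘ (⇑(algebraMap L (AdeleRing (𝓞 L) L)) ∘ y₀)) (⇑(algebraMap L (AdeleRing (𝓞 L) L)) ∘ y₀))) := by
    rw [Matrix.map_smul' _ _ _ (map_mul _), Matrix.map_mul, hTi, hG, hbc, map_mul, Matrix.smul_mul, Matrix.trace_smul, Matrix.mul_smul, Matrix.smul_mul,
      Matrix.trace_smul, Matrix.trace_smul, smul_eq_mul, smul_eq_mul, smul_eq_mul, Matrix.trace_mul_comm _ X, ← Matrix.mul_assoc]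
    ring
  -- (4) assemble: `ψ_{L⁺}(2 re τ) = ψ_L(τ)` since `τ` is `c ⊗ 1`-fixed
  rw [htrace] at hreal
  rw [sdChar_apply, ← sdForm_apply, hLHS, hy, unipDeltaChar_apply, htrace]
  conv_rhs => rw [eq_baseChange_re_of_conjAdele_eq L hreal]
  rw [hψ, two_mul]

end Index

/-! ## §5 The multiplier letter `hmult` of (KM′) at the mover of record -/

section Mult

variable (L : Type) [Field L] [NumberField L] [IsCMField L]
variable {N n : ℕ} (e : Fin N × Fin 1 ≃ Fin n)
  (dV : Fin N → L) (hdV : ∀ i, IsCMField.complexConj L (dV i) = dV i) (hdV0 : ∀ i, dV i ≠ 0)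
  (dW : Fin 1 → L) (hdW : ∀ i, IsCMField.complexConj L (dW i) = dW i) (hdW0 : ∀ i, dW i ≠ 0)
variable {n'' : ℕ} (e₁ : Fin (n + n) × Fin 1 ≃ Fin n'') (lam : IdeleClassGroup L →ₜ* Circle) (hlam : IsConjugateSymplectic L lam) (a' : (Fp L)ˣ)

set_option maxHeartbeats 1000000 in -- the statement carries the line datum's `pairRep` ∕ `toOp` telescope (as ★ p865126 §3)
/-- **(KM′)'s LETTER `hmult` BY NAME.**  In the κ-model of record `Tg := M_{r_F(κₙ)⁻¹}⁻¹` (★ p865126, the SAME `Tg` as the (B1c′) chain), a Siegel unipotent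
`u ∈ N_Δ(𝔸)` acts at every rational point `ratPt ξ` by the unipotent character of the index `Q ξ`:
`(Tg (ω(toDiagA u, 1) (Tg⁻¹ Ψ)))(ratPt ξ) = ψ_{Q ξ}(u) · Ψ(ratPt ξ)` — ★ `pairRep_line_lineCayley_eq_chirpLM` at the reading `hS := ★ aMat_cMat_lineKappa_of_mem_unipDelta (.2)`,
`coe_chirpLM`, `chirp_apply`, and §4 `sdChar_negHalf_chirpBlock_ratPt_eq_unipDeltaChar`. [cite: Weil1964, Chap. I n° 13 p. 160, n° 34 p. 184] [cite: Kudla1994, §3]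
[cite: Shimura1997, §18.1 (18.4)] -/
theorem kappaMultiplier_ratPt (u : ↥(unipDelta L e dV hdV dW hdW)) (Ψ : piSchwartzBruhat (Fp L) (Fin n'')) (ξ : Fin n'' → Fp L) :
    (((MpPsi.toOp (adelicSchrodinger (Fp L) (Fin n'') (adelicGram (Fp L) e₁ (realDiagonal L (dD L e dV hdV dW hdW) (dD_conj L e dV hdV dW hdW)) (TW (Fp L) a')))
      ((((ratThetaLiftCont (Fp L) (adelicGram (Fp L) e₁ (realDiagonal L (dD L e dV hdV dW hdW) (dD_conj L e dV hdV dW hdW)) (TW (Fp L) a'))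
        (isUnit_det_adelicGram (Fp L) e₁
            (isUnit_det_realDiagonal L (dD L e dV hdV dW hdW) (dD_conj L e dV hdV dW hdW) (dD_ne_zero L e dV hdV dW hdW hdV0 hdW0))
            (isUnit_det_TW (Fp L) a')) (⟨_, lineCayleyMover_mem_symplecticGroup (Fp L) n ((Equiv.prodUnique (Fin (n + n)) (Fin 1)).symm.trans e₁) (Units.mul_inv a')⟩ : Matrix.symplecticGroup (Fin n'') (Fp L)))⁻¹ :
        adelicMpCont (Fp L) (Fin n'') (adelicGram (Fp L) e₁ (realDiagonal L (dD L e dV hdV dW hdW) (dD_conj L e dV hdV dW hdW)) (TW (Fp L) a'))) :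
        adelicMp (Fp L) (Fin n'') (adelicGram (Fp L) e₁ (realDiagonal L (dD L e dV hdV dW hdW) (dD_conj L e dV hdV dW hdW)) (TW (Fp L) a'))))).symm
        (pairRep (Fp L) L (IsCMField.complexConj L) (n + n) 1 e₁ (Matrix.diagonal (dD L e dV hdV dW hdW)) (JW (Fp L) L a')
          (chiSplittingLine L e₁ (dD L e dV hdV dW hdW) (dD_conj L e dV hdV dW hdW) (dD_ne_zero L e dV hdV dW hdW hdV0 hdW0)
            (toHeckeCharacter L lam) (isUnitary_toHeckeCharacter L lam)
            ((isOscillatorChar_toHeckeCharacter_iff lam).mpr hlam) (TW (Fp L) a')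
            (isUnit_det_TW (Fp L) a') (JW (Fp L) L a') (JW_eq (Fp L) L a'))
          (toDiagA L e dV hdV dW hdW (u : HA L e dV hdV dW hdW), 1)
          ((MpPsi.toOp (adelicSchrodinger (Fp L) (Fin n'') (adelicGram (Fp L) e₁ (realDiagonal L (dD L e dV hdV dW hdW) (dD_conj L e dV hdV dW hdW)) (TW (Fp L) a')))
          ((((ratThetaLiftCont (Fp L) (adelicGram (Fp L) e₁ (realDiagonal L (dD L e dV hdV dW hdW) (dD_conj L e dV hdV dW hdW)) (TW (Fp L) a'))
        (isUnit_det_adelicGram (Fp L) e₁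
            (isUnit_det_realDiagonal L (dD L e dV hdV dW hdW) (dD_conj L e dV hdV dW hdW) (dD_ne_zero L e dV hdV dW hdW hdV0 hdW0))
            (isUnit_det_TW (Fp L) a')) (⟨_, lineCayleyMover_mem_symplecticGroup (Fp L) n ((Equiv.prodUnique (Fin (n + n)) (Fin 1)).symm.trans e₁) (Units.mul_inv a')⟩ : Matrix.symplecticGroup (Fin n'') (Fp L)))⁻¹ :
        adelicMpCont (Fp L) (Fin n'') (adelicGram (Fp L) e₁ (realDiagonal L (dD L e dV hdV dW hdW) (dD_conj L e dV hdV dW hdW)) (TW (Fp L) a'))) :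
        adelicMp (Fp L) (Fin n'') (adelicGram (Fp L) e₁ (realDiagonal L (dD L e dV hdV dW hdW) (dD_conj L e dV hdV dW hdW)) (TW (Fp L) a'))))) Ψ)) :
        piSchwartzBruhat (Fp L) (Fin n'')) : (Fin n'' → AdeleRing (𝓞 (Fp L)) (Fp L)) → ℂ) (ratPt (Fp L) (Fin n'') ξ) =
      ((unipDeltaChar L e dV hdV dW hdW
        ((imagUnit L * algebraMap (Fp L) L ((a' : Fp L) / (4 * imagUnitSq L))) •
          (((gramR L e dV hdV dW hdW).map (algebraMap (Fp L) L))⁻¹ *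
            Matrix.vecMulVec (⇑(IsCMField.complexConj L) ∘ fun i =>
                algebraMap (Fp L) L (((fun j => ξ (((e₂ (n := n)).trans ((Equiv.prodUnique (Fin (n + n)) (Fin 1)).symm.trans e₁)) (Sum.inl j))) ᵥ*
                  gramR L e dV hdV dW hdW) i) - 2 * (algebraMap (Fp L) L (ξ (((e₂ (n := n)).trans ((Equiv.prodUnique (Fin (n + n)) (Fin 1)).symm.trans e₁)) (Sum.inr i))) * imagUnit L))
              (fun i => algebraMap (Fp L) L (((fun j => ξ (((e₂ (n := n)).trans ((Equiv.prodUnique (Fin (n + n)) (Fin 1)).symm.trans e₁)) (Sum.inl j))) ᵥ*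
                  gramR L e dV hdV dW hdW) i) - 2 * (algebraMap (Fp L) L (ξ (((e₂ (n := n)).trans ((Equiv.prodUnique (Fin (n + n)) (Fin 1)).symm.trans e₁)) (Sum.inr i))) * imagUnit L))))
        (u : HA L e dV hdV dW hdW) : Circle) : ℂ) *
        ((Ψ : piSchwartzBruhat (Fp L) (Fin n'')) : (Fin n'' → AdeleRing (𝓞 (Fp L)) (Fp L)) → ℂ) (ratPt (Fp L) (Fin n'') ξ) := by
  -- the reading `(−½) • c_{q_u} = (−½) • ‹closed form›` (★ p863869 (.2))
  have hS := congrArg (HSMul.hSMul (-⅟(2 : AdeleRing (𝓞 (Fp L)) (Fp L))))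
    (aMat_cMat_lineKappa_of_mem_unipDelta L e dV hdV hdV0 dW hdW hdW0 e₁ a'
      (isUnit_det_adelicGram (Fp L) e₁
        (isUnit_det_realDiagonal L (dD L e dV hdV dW hdW) (dD_conj L e dV hdV dW hdW) (dD_ne_zero L e dV hdV dW hdW hdV0 hdW0)) (isUnit_det_TW (Fp L) a'))
      (JW (Fp L) L a') (realDiagonal_isSymm L (dD L e dV hdV dW hdW) (dD_conj L e dV hdV dW hdW)) (isSymm_TW (Fp L) a')
      (realDiagonal_map L (dD L e dV hdV dW hdW) (dD_conj L e dV hdV dW hdW)).symm (JW_eq (Fp L) L a') u.2).2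
  rw [pairRep_line_lineCayley_eq_chirpLM L e dV hdV dW hdW e₁ hdV0 hdW0 lam hlam a' u.2 hS Ψ, coe_chirpLM, chirp_apply,
    sdChar_negHalf_chirpBlock_ratPt_eq_unipDeltaChar L e dV hdV hdV0 dW hdW hdW0 e₁ a' u.2 ξ]

end Mult

end Summit.HodgeConjecture.HodgeConjecture.Cruxes.HLiu418.K2LiuKappaMultiplierIndexGram

end
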